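import Summits.HodgeConjecture.HodgeConjecture.Theorems.F0P2oYCoinvariantsChartCM          -- (E1-CM) p835408: the chart of the CM closer
import Summits.HodgeConjecture.HodgeConjecture.Theorems.F0P2oFibreDescentImplementer         -- ★ p835295 (E2): descent to `S_Y` implements `g₀`
import Summits.HodgeConjecture.HodgeConjecture.Theorems.F0P2oLineFibreChart                  -- (E3-gen) p835407: the line fibre chart `Γ₁`
import Summits.HodgeConjecture.HodgeConjecture.Theorems.F0P2oDictionaryUpToCharacter         -- ★ A-p12 (o3): `exists_character_dictionary`
import Summits.HodgeConjecture.HodgeConjecture.Theorems.F0P2oJacquetTwistSwapChart           -- ★ p834408 A-p12: `exists_rep_chart_law`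
import Literature.NumberTheory.GelbartRogawski1991.ThetaDichotomyVocabulary                  -- ★ `lineWeilCM`, `lineSplittingsCM`, `kernelLineCM`
import Literature.NumberTheory.GelbartRogawski1991.CMThetaTypeVocabulary                     -- ★ `chiLocalSplittingsCM`
import Literature.NumberTheory.Automorphic.UnitaryGroupFinAdelicCenterLocal                  -- ★ `localCenter`, `coe_localCenter`, `localCenter_comm`
import Literature.RepresentationTheory.HeisenbergGroup.SchrodingerCommutantPi                -- ★ `implementerUniqueUpToScalar_schrodingerSB_pi`
import Literature.NumberTheory.Automorphic.UnitaryGroupFrameSubform                          -- ★ `det_formCongr`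
import Summits.HodgeConjecture.HodgeConjecture.Theorems.F0P2oCmLineDockingMatrix             -- ★ p832169 `iota_fst_reIm`
import HarnessLib

/-!
# Crux `H413`, programme P2, N3 road (a)-block (E4-CM) — THE (S5) DICTIONARY UP TO A CHARACTER: a Jacquet chart `(π, σ)` of the local Weil representation at a
# non-split place and a model isomorphism `Tr` onto GR՚s `ω¹ = lineWeilCM` with `ω¹(u) ∘ Tr = η(u) • Tr ∘ σ(u)` for a CHARACTER `η` of `E¹_v`

Cell hodgecm-mathlib (D-0151), FLOOR 0, crux item H413 = stmt-HodgeConjecture-24833, programme P2; N3 road (`F0/P2/B-p18/g28/N3-ROAD.v2.B-p18g28.md`),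
(a)-block, row (S5) «THE DICTIONARY» (lead B-p18 (g28) 20:49:54Z, desk F0P2-plan (g8) 20:50:18Z ∕ 21:29:25Z), seat F0P2-p01 (g8).  THEOREMS ONLY (no `def`, no
instance, no notation, no named fact, no `sorry`); never imports a `Cruxes/…/Lines` module; kernel lane `--supports stmt-HodgeConjecture-24833 --as helper`.
HC_CM is proved only modulo the printed citations until rung 0 closes; nothing printed is asserted here.

THE SOCKET.  ★ p834861 ∕ ★ p835111 `nonempty_jacquet_xThetaGqsCM_equiv_weightSpace_of_dictionary ∕ _of_continuous′` (A-p12 (g17)) prove LETTER (a) of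
★ `GelbartRogawski1991.thetaType_nonsplit_jacquetModule` from a DICTIONARY CHART `(π, hπ, hker, σ, hσ, Tr, c, hTr, hχ)`.  This file DELIVERS
`(π, hπ, hker, σ, hσ, Tr, η, hTr)` with a character `η : E¹_v →* ℂˣ` in the slot `c` — everything but the VALUE of the character (`hχ` ⟺ `η = μ_v⁻¹ ∘ det`,
N3 (b)՚s `m(β)`-weight (D3d) composed with Kudla additivity `ν = 1`, the remaining block (N)).

THE PROOF (all inputs ★): `π := φ₀ ∘ Ψ` from the chart of the closer (E1-CM); `σ` from ★ `exists_rep_chart_law` (the centre commutes with `N`); the centre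
`u·1` is `ch (z u)`, `z u := localPiEquiv (localCenter u) ∈ U(Φ₃)(L⁺_v)`, matrix `au • 1`, so `s′ (z u)` is `Y`-stable and acts on `𝕎₁ = Y^⊥ ∕ Y` by `z ↦ au z`;
its (E2) descent IS `σ u` and implements `Γ₁ ∘ ι₁(u·1) ∘ Γ₁⁻¹` for the line fibre chart `Γ₁` of (E3) at `κ = a²ε ∕ det T` (`N(κ) = a₀ t₁` by the determinant of the
form congruence) — the symplectic component of the rank-one package transported along `(Γ₁, Ψ₁)`; ★ `exists_character_dictionary` gives `η`; `Tr := Ψ₁⁻¹`.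
[GelbartRogawski1991, §3.2 (3.2.1)–(3.2.3) p. 457; Kudla1986, Thm. 2.8; MoeglinVignerasWaldspurger1987, Chap. 2 II.1, Chap. 3 §IV.2, §IV.5; Jacobowitz1962, Thm. 3.1.]

## References
* [GelbartRogawski1991] S. Gelbart, J. Rogawski, Invent. Math. 105 (1991): §3.2 (3.2.1)–(3.2.3) p. 457; §5.2 p. 467 L8–11.
* [Kudla1986] S. Kudla, *On the local theta-correspondence*, Invent. Math. 83 (1986): Thm. 2.8.
* [MoeglinVignerasWaldspurger1987] C. Mœglin, M.-F. Vignéras, J.-L. Waldspurger, LNM 1291 (1987): Chap. 2 II.1; Chap. 3 §IV.2, §IV.5.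
* [Jacobowitz1962] R. Jacobowitz, Amer. J. Math. 84 (1962): Thm. 3.1.
-/

set_option autoImplicit false
set_option linter.dupNamespace false -- the mandated namespace repeats the single-problem summit's segment

noncomputable section

open scoped MatrixGroups Kronecker
open _root_.Matrix NumberField IsDedekindDomain
open Literature.NumberTheory.Automorphic Literature.NumberTheory.Automorphic.UnitaryGroup
open Literature.NumberTheory.Automorphic.UnitaryGroup.QuadraticCoordinates Literature.NumberTheory.Automorphic.UnitaryGroup.IsQuadraticCoordinates
open Literature.NumberTheory.Automorphic.Liu2021 Literature.NumberTheory.Automorphic.Liu2021.Def411WeilCarriers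
open Literature.NumberTheory.Automorphic.IdeleClassGroup
open Literature.NumberTheory.GaloisRepresentations
open Literature.NumberTheory.GelbartRogawski1991 Literature.NumberTheory.GelbartRogawski1991.UnitaryDualPair
open Literature.NumberTheory.GelbartRogawski1991.UnitaryDualPair.LocalSplitting
open Literature.RepresentationTheory Literature.RepresentationTheory.HeisenbergGroup Literature.RepresentationTheory.Liu2021 Representation
open Literature.NumberTheory Literature.NumberTheory.Rogawski1990 Literature.NumberTheory.GelbartRogawski1991.UnitaryDualPair.WeilCoinv
open Summit.HodgeConjecture.HodgeConjecture.Cruxes.H413.F0P2oYCoinvariantsChartCM Summit.HodgeConjecture.HodgeConjecture.Cruxes.H413.F0P2oFibreDescentImplementer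
open Summit.HodgeConjecture.HodgeConjecture.Cruxes.H413.F0P2oLineFibreChart Summit.HodgeConjecture.HodgeConjecture.Cruxes.H413.F0P2oDictionaryUpToCharacter
open Summit.HodgeConjecture.HodgeConjecture.Cruxes.H413.F0P2oJacquetTwistSwapChart Summit.HodgeConjecture.HodgeConjecture.Cruxes.H413.F0P2oHeisenbergYCoinvariants
open Summit.HodgeConjecture.HodgeConjecture.Cruxes.H413.F0P2oCmLineDockingMatrix

namespace Summit.HodgeConjecture.HodgeConjecture.Cruxes.H413.F0P2oLineWeilDictionaryUpToChar

variable (L : Type) [Field L] [NumberField L] [IsCMField L]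

set_option synthInstance.maxHeartbeats 400000 in
set_option maxHeartbeats 24000000 in -- one CM-carrier theorem assembling five ★ bricks (★ p832817's discharge profile ×1.5); the budget is cumulative
/-- **THE (S5) DICTIONARY UP TO A CHARACTER** (A-p12՚s socket `(π, hπ, hker, σ, hσ, Tr, c, hTr)` of ★ p834861 ∕ p835111 with the character FREE).  For a CM field `L`, a
real non-zero diagonal frame `dV` (`e₁ : Fin 3 × Fin 1 ≃ Fin n′`), the kernel-line reindexing `e₀ : Fin 1 × Fin 1 ≃ Fin n₀`, `μ` conjugate-symplectic, a line `ε`,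
a place `v` of `L⁺` NOT split in `L` and a form congruence `(T, a, h)` reading `X_v` on `U(Φ₃)(L⁺_v)`: there are a Jacquet chart `π : 𝒮(L⁺_v^{n′}) ↠ 𝒮(L⁺_v)` of
`ω_v ∘ ch` along `N` (kernel = the `N`-coboundaries, in the closer՚s spelling), the descended action `σ` of the centre `U((ε))(L⁺_v) = E¹_v` (`π ∘ ω_v(u·1) = σ(u) ∘ π`),
a model isomorphism `Tr : 𝒮(L⁺_v) ≃ₗ 𝒮(L⁺_v^{n₀})` onto the carrier of GR՚s `ω¹ = lineWeilCM … (kernelLineCM dV) … ε v`, and a CHARACTER `η` of `E¹_v` with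
**`ω¹(u) (Tr s) = η(u) • Tr (σ u s)`**.  (`π = φ₀ ∘ Ψ` of ★ (E1-CM); `σ u` = the (E2) descent of the frame-diagonal centre; `Tr⁻¹` = the intertwiner over the line fibre
chart (E3) `Γ₁ : c ↦ (a₀⁻¹ re(κc), im(κc))`, `κ = a²ε∕det T`; `η` by ★ A-p12 `exists_character_dictionary`.)  Letter (a) of ★ `thetaType_nonsplit_jacquetModule` follows from
★ `nonempty_jacquet_xThetaGqsCM_equiv_weightSpace_of_dictionary` once `η = μ_v⁻¹ ∘ det` — N3 (b)՚s `m(β)`-weight (D3d) and Kudla additivity `ν = 1` (N).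
[cite: GelbartRogawski1991, §3.2 (3.2.1)–(3.2.3) p. 457; §5.2 p. 467 L8–11] [cite: Kudla1986, Thm. 2.8] [cite: MoeglinVignerasWaldspurger1987, Chap. 2 II.1; Chap. 3 §IV.2, §IV.5] -/
theorem exists_dictionary_upToChar {n' : ℕ} (e₁ : Fin 3 × Fin 1 ≃ Fin n') (dV : Fin 3 → L)
    (hdV : ∀ i, IsCMField.complexConj L (dV i) = dV i) (hdV0 : ∀ i, dV i ≠ 0) {n₀ : ℕ} (e₀ : Fin 1 × Fin 1 ≃ Fin n₀)
    (μ : Literature.NumberTheory.Automorphic.IdeleClassGroup L →ₜ* Circle) (hμ : IsConjugateSymplectic L μ)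
    (ε : (↥(maximalRealSubfield L))ˣ) (v : HeightOneSpectrum (𝓞 ↥(maximalRealSubfield L))) (hv : ∀ w : PlacesOver L v, IsCMField.complexConj L • w.1 = w.1)
    (T : GL (Fin 3) (UnitaryGroup.LocalRing L v)) {a : UnitaryGroup.LocalRing L v} (ha : IsUnit a)
    (h : formCongr (conjLocal L (IsCMField.complexConj L) v) T ((Matrix.diagonal dV).map (algebraMap L (UnitaryGroup.LocalRing L v))) =
      a • (Matrix.of fun i j : Fin 3 => if i.val + j.val + 1 = 3 then (1 : L) else 0).map (algebraMap L (UnitaryGroup.LocalRing L v))) :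
    ∃ (π : SchwartzBruhat (Fin n' → (v.adicCompletion ↥(maximalRealSubfield L))) →ₗ[ℂ] SchwartzBruhat (Fin 1 → (v.adicCompletion ↥(maximalRealSubfield L))))
      (σ : Representation ℂ (localPi L (IsCMField.complexConj L) 1 (JW (↥(maximalRealSubfield L)) L ε) v) (SchwartzBruhat (Fin 1 → (v.adicCompletion ↥(maximalRealSubfield L)))))
      (Tr : SchwartzBruhat (Fin 1 → (v.adicCompletion ↥(maximalRealSubfield L))) ≃ₗ[ℂ] SchwartzBruhat (Fin n₀ → (v.adicCompletion ↥(maximalRealSubfield L))))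
      (η : (localPi L (IsCMField.complexConj L) 1 (JW (↥(maximalRealSubfield L)) L ε) v) →* ℂˣ),
      Function.Surjective π ∧
      LinearMap.ker π = Coinvariants.ker
        ((((MpPsi.toRep (localSchrodinger (↥(maximalRealSubfield L)) n' (gram (↥(maximalRealSubfield L)) e₁ (realDiagonal L dV hdV) (TW (↥(maximalRealSubfield L)) ε)) v)).comp ((chiLocalSplittingsCM L e₁ dV hdV hdV0 (toHeckeCharacter L μ) ((isOscillatorChar_toHeckeCharacter_iff μ).mpr hμ) ε).s v)).comp
        ((localLineInl L (IsCMField.complexConj L) 3 e₁ (Matrix.diagonal dV) (JW (↥(maximalRealSubfield L)) L ε) v).comp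
            ((localPiEquiv L (IsCMField.complexConj L) 3 (Matrix.diagonal dV) v).symm.toMonoidHom.comp (cmDatumLocalCongr L v T ha h).toMonoidHom))).comp (cmBorelTriple L 3 v).N.subtype) ∧
      (∀ (u : (localPi L (IsCMField.complexConj L) 1 (JW (↥(maximalRealSubfield L)) L ε) v)) (f : SchwartzBruhat (Fin n' → (v.adicCompletion ↥(maximalRealSubfield L)))),
        π (MpPsi.toRep (localSchrodinger (↥(maximalRealSubfield L)) n' (gram (↥(maximalRealSubfield L)) e₁ (realDiagonal L dV hdV) (TW (↥(maximalRealSubfield L)) ε)) v)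
          ((chiLocalSplittingsCM L e₁ dV hdV hdV0 (toHeckeCharacter L μ) ((isOscillatorChar_toHeckeCharacter_iff μ).mpr hμ) ε).s v
            (localCenter L (IsCMField.complexConj L) n' (Matrix.reindex e₁ e₁ (Matrix.diagonal dV ⊗ₖ JW (↥(maximalRealSubfield L)) L ε)) (JW (↥(maximalRealSubfield L)) L ε) (JW_apply_ne_zero (↥(maximalRealSubfield L)) L ε) v u)) f) = σ u (π f)) ∧
      (∀ (u : (localPi L (IsCMField.complexConj L) 1 (JW (↥(maximalRealSubfield L)) L ε) v)) (s : SchwartzBruhat (Fin 1 → (v.adicCompletion ↥(maximalRealSubfield L)))),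
        lineWeilCM L e₀ (kernelLineCM dV) (complexConj_kernelLineCM dV hdV) (kernelLineCM_ne_zero dV hdV0) μ hμ ε v u (Tr s) = ((η u : ℂˣ) : ℂ) • Tr (σ u s)) := by
  classical
  obtain ⟨uu, a₀, Γ, Ψ, s', φ₀, ⟨huu, hua₀⟩, hH, h1, halt, h2, h3, h4, hφ₀, hker⟩ :=
    exists_chart_of_nonsplit L e₁ dV hdV hdV0 ε v hv (chiLocalSplittingsCM L e₁ dV hdV hdV0 (toHeckeCharacter L μ) ((isOscillatorChar_toHeckeCharacter_iff μ).mpr hμ) ε) T ha h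
  -- quadratic coordinates and the scalar lemmas
  have hq := isQuadraticCoordinates_local L v (IsCMField.complexConj L) (complexConj_imagUnit L) (imagUnit_ne_zero L) (imagUnit_mul_self L)
  have hψ := isContinuousNontrivial_adeleAddCharAt (↥(maximalRealSubfield L)) v
  have hb₀ : ∀ y₀ : Fin 1 → (v.adicCompletion ↥(maximalRealSubfield L)), Continuous fun u₀ : Fin 1 → (v.adicCompletion ↥(maximalRealSubfield L)) => dotProductBilin (v.adicCompletion ↥(maximalRealSubfield L)) (v.adicCompletion ↥(maximalRealSubfield L)) u₀ y₀ := fun y => continuous_dotProductBilin_left y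
  have hzero : ∀ z : (UnitaryGroup.LocalRing L v), re (quadraticLocalEquiv L v (IsCMField.complexConj L) (complexConj_imagUnit L) (imagUnit_ne_zero L)).toLinearEquiv.toAddEquiv z = 0 → im (quadraticLocalEquiv L v (IsCMField.complexConj L) (complexConj_imagUnit L) (imagUnit_ne_zero L)).toLinearEquiv.toAddEquiv z = 0 → z = 0 := fun z hr hi => by
    rw [← hq.re_add_im z, hr, hi, map_zero, zero_mul, add_zero]
  obtain ⟨π, hπdef⟩ : ∃ π : SchwartzBruhat (Fin n' → (v.adicCompletion ↥(maximalRealSubfield L))) →ₗ[ℂ] SchwartzBruhat (Fin 1 → (v.adicCompletion ↥(maximalRealSubfield L))), π = φ₀ ∘ₗ (Ψ : _ →ₗ[ℂ] _) := ⟨_, rfl⟩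
  have hπap : ∀ f, π f = φ₀ (Ψ f) := fun f => by rw [hπdef]; rfl
  have hπ : Function.Surjective π := by rw [hπdef]; exact (fibreZero_surjective φ₀ hφ₀).comp Ψ.surjective
  have hkerπ : LinearMap.ker π = Coinvariants.ker ((((MpPsi.toRep (localSchrodinger (↥(maximalRealSubfield L)) n' (gram (↥(maximalRealSubfield L)) e₁ (realDiagonal L dV hdV) (TW (↥(maximalRealSubfield L)) ε)) v)).comp ((chiLocalSplittingsCM L e₁ dV hdV hdV0 (toHeckeCharacter L μ) ((isOscillatorChar_toHeckeCharacter_iff μ).mpr hμ) ε).s v)).comp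
        ((localLineInl L (IsCMField.complexConj L) 3 e₁ (Matrix.diagonal dV) (JW (↥(maximalRealSubfield L)) L ε) v).comp
            ((localPiEquiv L (IsCMField.complexConj L) 3 (Matrix.diagonal dV) v).symm.toMonoidHom.comp (cmDatumLocalCongr L v T ha h).toMonoidHom))).comp (cmBorelTriple L 3 v).N.subtype) := by
    rw [hπdef, LinearMap.ker_comp, hker]
  obtain ⟨ρ, hρ⟩ : ∃ ρ : Representation ℂ ((cmDatum L 3 (Matrix.of fun i j : Fin 3 => if i.val + j.val + 1 = 3 then (1 : L) else 0)).Local v) (SchwartzBruhat (Fin n' → (v.adicCompletion ↥(maximalRealSubfield L)))),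
      ρ = ((MpPsi.toRep (localSchrodinger (↥(maximalRealSubfield L)) n' (gram (↥(maximalRealSubfield L)) e₁ (realDiagonal L dV hdV) (TW (↥(maximalRealSubfield L)) ε)) v)).comp ((chiLocalSplittingsCM L e₁ dV hdV hdV0 (toHeckeCharacter L μ) ((isOscillatorChar_toHeckeCharacter_iff μ).mpr hμ) ε).s v)).comp
        ((localLineInl L (IsCMField.complexConj L) 3 e₁ (Matrix.diagonal dV) (JW (↥(maximalRealSubfield L)) L ε) v).comp
            ((localPiEquiv L (IsCMField.complexConj L) 3 (Matrix.diagonal dV) v).symm.toMonoidHom.comp (cmDatumLocalCongr L v T ha h).toMonoidHom)) := ⟨_, rfl⟩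
  obtain ⟨ρW, hρW⟩ : ∃ ρW : Representation ℂ (localPi L (IsCMField.complexConj L) 1 (JW (↥(maximalRealSubfield L)) L ε) v) (SchwartzBruhat (Fin n' → (v.adicCompletion ↥(maximalRealSubfield L)))),
      ρW = ((MpPsi.toRep (localSchrodinger (↥(maximalRealSubfield L)) n' (gram (↥(maximalRealSubfield L)) e₁ (realDiagonal L dV hdV) (TW (↥(maximalRealSubfield L)) ε)) v)).comp ((chiLocalSplittingsCM L e₁ dV hdV hdV0 (toHeckeCharacter L μ) ((isOscillatorChar_toHeckeCharacter_iff μ).mpr hμ) ε).s v)).comp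
        (localCenter L (IsCMField.complexConj L) n' (Matrix.reindex e₁ e₁ (Matrix.diagonal dV ⊗ₖ JW (↥(maximalRealSubfield L)) L ε)) (JW (↥(maximalRealSubfield L)) L ε) (JW_apply_ne_zero (↥(maximalRealSubfield L)) L ε) v) := ⟨_, rfl⟩
  have hρWap : ∀ u f, ρW u f = MpPsi.toRep (localSchrodinger (↥(maximalRealSubfield L)) n' (gram (↥(maximalRealSubfield L)) e₁ (realDiagonal L dV hdV) (TW (↥(maximalRealSubfield L)) ε)) v) ((chiLocalSplittingsCM L e₁ dV hdV hdV0 (toHeckeCharacter L μ) ((isOscillatorChar_toHeckeCharacter_iff μ).mpr hμ) ε).s v (localCenter L (IsCMField.complexConj L) n' (Matrix.reindex e₁ e₁ (Matrix.diagonal dV ⊗ₖ JW (↥(maximalRealSubfield L)) L ε)) (JW (↥(maximalRealSubfield L)) L ε) (JW_apply_ne_zero (↥(maximalRealSubfield L)) L ε) v u)) f := fun u f => by rw [hρW]; rfl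
  have hcomm : ∀ (n : ↥(cmBorelTriple L 3 v).N) (u : (localPi L (IsCMField.complexConj L) 1 (JW (↥(maximalRealSubfield L)) L ε) v)), Commute (ρ n.1) (ρW u) := by
    intro n u
    rw [hρ, hρW]
    have hc0 : Commute (((localLineInl L (IsCMField.complexConj L) 3 e₁ (Matrix.diagonal dV) (JW (↥(maximalRealSubfield L)) L ε) v).comp
            ((localPiEquiv L (IsCMField.complexConj L) 3 (Matrix.diagonal dV) v).symm.toMonoidHom.comp (cmDatumLocalCongr L v T ha h).toMonoidHom)) n.1) (localCenter L (IsCMField.complexConj L) n' (Matrix.reindex e₁ e₁ (Matrix.diagonal dV ⊗ₖ JW (↥(maximalRealSubfield L)) L ε)) (JW (↥(maximalRealSubfield L)) L ε) (JW_apply_ne_zero (↥(maximalRealSubfield L)) L ε) v u) :=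
      localCenter_comm L (IsCMField.complexConj L) n' (Matrix.reindex e₁ e₁ (Matrix.diagonal dV ⊗ₖ JW (↥(maximalRealSubfield L)) L ε)) (JW (↥(maximalRealSubfield L)) L ε) (JW_apply_ne_zero (↥(maximalRealSubfield L)) L ε) v u _
    exact (hc0.map ((chiLocalSplittingsCM L e₁ dV hdV hdV0 (toHeckeCharacter L μ) ((isOscillatorChar_toHeckeCharacter_iff μ).mpr hμ) ε).s v)).map (MpPsi.toRep (localSchrodinger (↥(maximalRealSubfield L)) n' (gram (↥(maximalRealSubfield L)) e₁ (realDiagonal L dV hdV) (TW (↥(maximalRealSubfield L)) ε)) v))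
  have hkerρ : LinearMap.ker π = Coinvariants.ker (ρ.comp (cmBorelTriple L 3 v).N.subtype) := by rw [hρ]; exact hkerπ
  obtain ⟨σ, hσ⟩ := exists_rep_chart_law ρ ρW (cmBorelTriple L 3 v) hcomm π hπ hkerρ
  have hσ' : ∀ (u : (localPi L (IsCMField.complexConj L) 1 (JW (↥(maximalRealSubfield L)) L ε) v)) (f : SchwartzBruhat (Fin n' → (v.adicCompletion ↥(maximalRealSubfield L)))),
      π (MpPsi.toRep (localSchrodinger (↥(maximalRealSubfield L)) n' (gram (↥(maximalRealSubfield L)) e₁ (realDiagonal L dV hdV) (TW (↥(maximalRealSubfield L)) ε)) v) ((chiLocalSplittingsCM L e₁ dV hdV hdV0 (toHeckeCharacter L μ) ((isOscillatorChar_toHeckeCharacter_iff μ).mpr hμ) ε).s v (localCenter L (IsCMField.complexConj L) n' (Matrix.reindex e₁ e₁ (Matrix.diagonal dV ⊗ₖ JW (↥(maximalRealSubfield L)) L ε)) (JW (↥(maximalRealSubfield L)) L ε) (JW_apply_ne_zero (↥(maximalRealSubfield L)) L ε) v u)) f) = σ u (π f) := fun u f => by rw [← hρWap]; exact hσ u 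f
  obtain ⟨au, hau⟩ : ∃ au : (localPi L (IsCMField.complexConj L) 1 (JW (↥(maximalRealSubfield L)) L ε) v) → (UnitaryGroup.LocalRing L v), au = fun (u : (localPi L (IsCMField.complexConj L) 1 (JW (↥(maximalRealSubfield L)) L ε) v)) (w : UnitaryGroup.PlacesOver L v) =>
      ((u.1 w : GL (Fin 1) (w.1.adicCompletion L)) : Matrix (Fin 1) (Fin 1) (w.1.adicCompletion L)) 0 0 := ⟨_, rfl⟩
  have hsc : ∀ (N : ℕ) (K : Matrix (Fin N) (Fin N) L) (u : (localPi L (IsCMField.complexConj L) 1 (JW (↥(maximalRealSubfield L)) L ε) v)),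
      ((localPiEquiv L (IsCMField.complexConj L) N K v (localCenter L (IsCMField.complexConj L) N K (JW (↥(maximalRealSubfield L)) L ε) (JW_apply_ne_zero (↥(maximalRealSubfield L)) L ε) v u)).1 : Matrix (Fin N) (Fin N) (UnitaryGroup.LocalRing L v)) = au u • (1 : Matrix (Fin N) (Fin N) (UnitaryGroup.LocalRing L v)) := by
    intro N K u
    refine Matrix.ext fun i j => funext fun w => ?_
    rw [coe_localPiEquiv_apply, GLn.coe_piEquiv_symm_apply, coe_localCenter, coe_localScalarGL_apply, Matrix.smul_apply, Matrix.smul_apply, hau,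
      smul_eq_mul, smul_eq_mul, Pi.mul_apply, Matrix.one_apply, Matrix.one_apply]
    split_ifs <;> rfl
  obtain ⟨z, hz⟩ : ∃ z : (localPi L (IsCMField.complexConj L) 1 (JW (↥(maximalRealSubfield L)) L ε) v) → (cmDatum L 3 (Matrix.of fun i j : Fin 3 => if i.val + j.val + 1 = 3 then (1 : L) else 0)).Local v, z = fun u =>
      localPiEquiv L (IsCMField.complexConj L) 3 (Matrix.of fun i j : Fin 3 => if i.val + j.val + 1 = 3 then (1 : L) else 0) v
        (localCenter L (IsCMField.complexConj L) 3 (Matrix.of fun i j : Fin 3 => if i.val + j.val + 1 = 3 then (1 : L) else 0) (JW (↥(maximalRealSubfield L)) L ε) (JW_apply_ne_zero (↥(maximalRealSubfield L)) L ε) v u) := ⟨_, rfl⟩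
  have hzmat : ∀ u, (((z u).val : GL (Fin 3) (UnitaryGroup.LocalRing L v)) : Matrix (Fin 3) (Fin 3) (UnitaryGroup.LocalRing L v)) = au u • (1 : Matrix (Fin 3) (Fin 3) (UnitaryGroup.LocalRing L v)) := fun u => by
    rw [hz]; exact hsc 3 _ u
  have hTzT : ∀ u, ((T : Matrix (Fin 3) (Fin 3) (UnitaryGroup.LocalRing L v)) * (((z u).val : GL (Fin 3) (UnitaryGroup.LocalRing L v)) : Matrix (Fin 3) (Fin 3) (UnitaryGroup.LocalRing L v)) *
      ((T⁻¹ : GL (Fin 3) (UnitaryGroup.LocalRing L v)) : Matrix (Fin 3) (Fin 3) (UnitaryGroup.LocalRing L v))) = au u • (1 : Matrix (Fin 3) (Fin 3) (UnitaryGroup.LocalRing L v)) := fun u => by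
    rw [hzmat, Matrix.mul_smul, Matrix.mul_one, Matrix.smul_mul, ← Units.val_mul, mul_inv_cancel, Units.val_one]
  have hchz : ∀ u, ((localLineInl L (IsCMField.complexConj L) 3 e₁ (Matrix.diagonal dV) (JW (↥(maximalRealSubfield L)) L ε) v).comp
            ((localPiEquiv L (IsCMField.complexConj L) 3 (Matrix.diagonal dV) v).symm.toMonoidHom.comp (cmDatumLocalCongr L v T ha h).toMonoidHom)) (z u) =
      (localCenter L (IsCMField.complexConj L) n' (Matrix.reindex e₁ e₁ (Matrix.diagonal dV ⊗ₖ JW (↥(maximalRealSubfield L)) L ε)) (JW (↥(maximalRealSubfield L)) L ε) (JW_apply_ne_zero (↥(maximalRealSubfield L)) L ε) v u) := by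
    intro u
    have hV' : cmDatumLocalCongr L v T ha h (z u) =
        localPiEquiv L (IsCMField.complexConj L) 3 (Matrix.diagonal dV) v (localCenter L (IsCMField.complexConj L) 3 (Matrix.diagonal dV) (JW (↥(maximalRealSubfield L)) L ε) (JW_apply_ne_zero (↥(maximalRealSubfield L)) L ε) v u) := by
      refine Subtype.ext (Units.ext ?_)
      rw [coe_cmDatumLocalCongr_apply, Units.val_mul, Units.val_mul, hTzT]
      exact (hsc 3 (Matrix.diagonal dV) u).symm
    have hV : (localPiEquiv L (IsCMField.complexConj L) 3 (Matrix.diagonal dV) v).symm (cmDatumLocalCongr L v T ha h (z u)) =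
        localCenter L (IsCMField.complexConj L) 3 (Matrix.diagonal dV) (JW (↥(maximalRealSubfield L)) L ε) (JW_apply_ne_zero (↥(maximalRealSubfield L)) L ε) v u := by
      rw [hV', (localPiEquiv L (IsCMField.complexConj L) 3 (Matrix.diagonal dV) v).symm_apply_apply]
    change localLineInl L (IsCMField.complexConj L) 3 e₁ (Matrix.diagonal dV) (JW (↥(maximalRealSubfield L)) L ε) v
      ((localPiEquiv L (IsCMField.complexConj L) 3 (Matrix.diagonal dV) v).symm (cmDatumLocalCongr L v T ha h (z u))) = _
    rw [hV, localLineInl_localCenter]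
  -- `Ψ` intertwines `ω_v(u·1)` with `toRep (s′ (z u))`, and `(s′ (z u))` acts through `Γ` by the scalar `au u`
  have h3z : ∀ u f, Ψ (MpPsi.toRep (localSchrodinger (↥(maximalRealSubfield L)) n' (gram (↥(maximalRealSubfield L)) e₁ (realDiagonal L dV hdV) (TW (↥(maximalRealSubfield L)) ε)) v) ((chiLocalSplittingsCM L e₁ dV hdV hdV0 (toHeckeCharacter L μ) ((isOscillatorChar_toHeckeCharacter_iff μ).mpr hμ) ε).s v (localCenter L (IsCMField.complexConj L) n' (Matrix.reindex e₁ e₁ (Matrix.diagonal dV ⊗ₖ JW (↥(maximalRealSubfield L)) L ε)) (JW (↥(maximalRealSubfield L)) L ε) (JW_apply_ne_zero (↥(maximalRealSubfield L)) L ε) v u)) f) = MpPsi.toRep (schrodingerSB (dotProductBilin (v.adicCompletion ↥(maximalRealSubfield L)) (v.adicCompletion ↥(maximalRealSubfield L)) (m := Fin 2 ⊕ Fin 1)) (adeleAddCharAt (↥(maximalRealSubfield L)) v) (isLocallyConstant_of_isContinuousNontrivial (isContinuousNontrivial_adeleAddCharAt (↥(maximalRealSubfield L)) v)) (fun y =>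 continuous_dotProductBilin_left y)) (s' (z u)) (Ψ f) := by
    intro u f
    have h := h3 (z u) f
    rw [MonoidHom.comp_apply ((chiLocalSplittingsCM L e₁ dV hdV hdV0 (toHeckeCharacter L μ) ((isOscillatorChar_toHeckeCharacter_iff μ).mpr hμ) ε).s v), hchz] at h
    exact h
  have h4z : ∀ u (x : Fin n' → (UnitaryGroup.LocalRing L v)), ((s' (z u)).1.1).1 (Γ (reIm (quadraticLocalEquiv L v (IsCMField.complexConj L) (complexConj_imagUnit L) (imagUnit_ne_zero L)).toLinearEquiv.toAddEquiv (Fin n') x)) = Γ (reIm (quadraticLocalEquiv L v (IsCMField.complexConj L) (complexConj_imagUnit L) (imagUnit_ne_zero L)).toLinearEquiv.toAddEquiv (Fin n') (au u • x)) := by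
    intro u x
    rw [h4 (z u) x, hTzT]
    congr 2
    rw [show Matrix.reindex e₁ e₁ ((au u • (1 : Matrix (Fin 3) (Fin 3) (UnitaryGroup.LocalRing L v))) ⊗ₖ (1 : Matrix (Fin 1) (Fin 1) (UnitaryGroup.LocalRing L v))) = au u • (1 : Matrix (Fin n') (Fin n') (UnitaryGroup.LocalRing L v)) by
        rw [Matrix.smul_kronecker, Matrix.one_kronecker_one]
        ext i j
        simp only [Matrix.reindex_apply, Matrix.submatrix_apply, Matrix.smul_apply, Matrix.one_apply, EmbeddingLike.apply_eq_iff_eq],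
      Matrix.smul_mulVec, Matrix.one_mulVec]
  have hσφ : ∀ x : (v.adicCompletion ↥(maximalRealSubfield L)), (conjLocal L (IsCMField.complexConj L) v) (toLocalRing L v x) = toLocalRing L v x := fun x => conjLocal_toLocalRing (IsCMField.complexConj L) v x
  have hσδ : (conjLocal L (IsCMField.complexConj L) v) (algebraMap L (UnitaryGroup.LocalRing L v) (imagUnit L)) = -algebraMap L (UnitaryGroup.LocalRing L v) (imagUnit L) := by
    rw [conjLocal_algebraMap, complexConj_imagUnit, map_neg]
  obtain ⟨dd, hdd⟩ : ∃ dd : (v.adicCompletion ↥(maximalRealSubfield L)), IsQuadraticCoordinates (toLocalRing L v) (quadraticLocalEquiv L v (IsCMField.complexConj L) (complexConj_imagUnit L) (imagUnit_ne_zero L)).toLinearEquiv.toAddEquiv (algebraMap L (UnitaryGroup.LocalRing L v) (imagUnit L)) dd := ⟨_, hq⟩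
  have hnorm : ∀ z : (UnitaryGroup.LocalRing L v), z * (conjLocal L (IsCMField.complexConj L) v) z = toLocalRing L v (re (quadraticLocalEquiv L v (IsCMField.complexConj L) (complexConj_imagUnit L) (imagUnit_ne_zero L)).toLinearEquiv.toAddEquiv z * re (quadraticLocalEquiv L v (IsCMField.complexConj L) (complexConj_imagUnit L) (imagUnit_ne_zero L)).toLinearEquiv.toAddEquiv z - dd * (im (quadraticLocalEquiv L v (IsCMField.complexConj L) (complexConj_imagUnit L) (imagUnit_ne_zero L)).toLinearEquiv.toAddEquiv z * im (quadraticLocalEquiv L v (IsCMField.complexConj L) (complexConj_imagUnit L) (imagUnit_ne_zero L)).toLinearEquiv.toAddEquiv z)) := by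
    intro z
    have hre : re (quadraticLocalEquiv L v (IsCMField.complexConj L) (complexConj_imagUnit L) (imagUnit_ne_zero L)).toLinearEquiv.toAddEquiv (z * (conjLocal L (IsCMField.complexConj L) v) z) = re (quadraticLocalEquiv L v (IsCMField.complexConj L) (complexConj_imagUnit L) (imagUnit_ne_zero L)).toLinearEquiv.toAddEquiv z * re (quadraticLocalEquiv L v (IsCMField.complexConj L) (complexConj_imagUnit L) (imagUnit_ne_zero L)).toLinearEquiv.toAddEquiv z - dd * (im (quadraticLocalEquiv L v (IsCMField.complexConj L) (complexConj_imagUnit L) (imagUnit_ne_zero L)).toLinearEquiv.toAddEquiv z * im (quadraticLocalEquiv L v (IsCMField.complexConj L) (complexConj_imagUnit L) (imagUnit_ne_zero L)).toLinearEquiv.toAddEquiv z) := by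
      rw [hdd.re_mul, hdd.re_conj hσφ hσδ, hdd.im_conj hσφ hσδ]; ring
    have him : im (quadraticLocalEquiv L v (IsCMField.complexConj L) (complexConj_imagUnit L) (imagUnit_ne_zero L)).toLinearEquiv.toAddEquiv (z * (conjLocal L (IsCMField.complexConj L) v) z) = 0 := by
      rw [hdd.im_mul, hdd.re_conj hσφ hσδ, hdd.im_conj hσφ hσδ]; ring
    rw [← hdd.re_add_im (z * (conjLocal L (IsCMField.complexConj L) v) z), hre, him, map_zero, zero_mul, add_zero]
  have ha₀ : a₀ ≠ 0 := fun h0 => uu.ne_zero (by rw [hua₀, h0, map_zero])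
  -- `ε̃`, reality of `a`, the determinant of the form congruence
  obtain ⟨εS, hεS⟩ : ∃ εS : (UnitaryGroup.LocalRing L v), εS = algebraMap L (UnitaryGroup.LocalRing L v) (algebraMap (↥(maximalRealSubfield L)) L (ε : (↥(maximalRealSubfield L)))) := ⟨_, rfl⟩
  have hεSu : IsUnit εS := by rw [hεS]; exact (ε.isUnit.map _).map _
  have hσε : (conjLocal L (IsCMField.complexConj L) v) εS = εS := by rw [hεS, conjLocal_algebraMap, AlgEquiv.commutes]
  have hσuu : (conjLocal L (IsCMField.complexConj L) v) (uu : (UnitaryGroup.LocalRing L v)) = uu := by rw [hua₀, hσφ]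
  have hσa : (conjLocal L (IsCMField.complexConj L) v) a = a := by
    have h1' : (conjLocal L (IsCMField.complexConj L) v) a * εS = a * εS := by
      have := congrArg (conjLocal L (IsCMField.complexConj L) v) huu
      rw [hσuu, map_mul, ← hεS, hσε, huu, ← hεS] at this
      exact this.symm
    exact hεSu.mul_left_injective h1'
  obtain ⟨Dv, hDv⟩ : ∃ Dv : (UnitaryGroup.LocalRing L v), Dv = algebraMap L (UnitaryGroup.LocalRing L v) (dV 0 * dV 1 * dV 2) := ⟨_, rfl⟩
  have hdetHV : ((Matrix.diagonal dV).map (algebraMap L (UnitaryGroup.LocalRing L v))).det = Dv := by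
    rw [hDv, Matrix.diagonal_map (map_zero _), Matrix.det_diagonal, Fin.prod_univ_three, ← map_mul, ← map_mul]
  have hdetΦ : ((Matrix.of fun i j : Fin 3 => if i.val + j.val + 1 = 3 then (1 : L) else 0).map (algebraMap L (UnitaryGroup.LocalRing L v))).det = -1 := by
    rw [Matrix.det_fin_three]
    simp [Matrix.map_apply, Matrix.of_apply]
  have hdet : (conjLocal L (IsCMField.complexConj L) v) (T : Matrix (Fin 3) (Fin 3) (UnitaryGroup.LocalRing L v)).det * Dv * (T : Matrix (Fin 3) (Fin 3) (UnitaryGroup.LocalRing L v)).det = -(a ^ 3) := by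
    have hh := congrArg Matrix.det h
    rw [det_formCongr, hdetHV, Matrix.det_smul, hdetΦ, Fintype.card_fin] at hh
    rw [hh]; ring
  obtain ⟨Xi, hXi⟩ : ∃ Xi : (UnitaryGroup.LocalRing L v), Xi = ((T⁻¹ : GL (Fin 3) (UnitaryGroup.LocalRing L v)) : Matrix (Fin 3) (Fin 3) (UnitaryGroup.LocalRing L v)).det := ⟨_, rfl⟩
  have hXi1 : Xi * (T : Matrix (Fin 3) (Fin 3) (UnitaryGroup.LocalRing L v)).det = 1 := by
    rw [hXi, ← Matrix.det_mul, ← Units.val_mul, inv_mul_cancel, Units.val_one, Matrix.det_one]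
  have hXi2 : (conjLocal L (IsCMField.complexConj L) v) Xi * (conjLocal L (IsCMField.complexConj L) v) (T : Matrix (Fin 3) (Fin 3) (UnitaryGroup.LocalRing L v)).det = 1 := by rw [← map_mul, hXi1, map_one]
  have hDv' : Dv = -(a ^ 3 * (Xi * (conjLocal L (IsCMField.complexConj L) v) Xi)) := by
    linear_combination (Xi * (conjLocal L (IsCMField.complexConj L) v) Xi) * hdet - (Dv * (conjLocal L (IsCMField.complexConj L) v) Xi * (conjLocal L (IsCMField.complexConj L) v) (T : Matrix (Fin 3) (Fin 3) (UnitaryGroup.LocalRing L v)).det) * hXi1 - Dv * hXi2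
  -- the kernel-line Gram matrix `T₁`, its real form `reindex e₀ (diag(kernelLine) ⊗ (ε))`, its entry `t₁`
  obtain ⟨eι, heι⟩ : ∃ eι : Fin n₀ ≃ Fin 1, eι = e₀.symm.trans (Equiv.prodUnique (Fin 1) (Fin 1)) := ⟨_, rfl⟩
  have hi₀ : eι.symm 0 = e₀ (0, 0) := by rw [heι]; rfl
  have hT₁d : IsUnit (localGram (↥(maximalRealSubfield L)) n₀ (gram (↥(maximalRealSubfield L)) e₀ (realDiagonal L (kernelLineCM dV) (complexConj_kernelLineCM dV hdV)) (TW (↥(maximalRealSubfield L)) ε)) v).det :=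
    isUnit_det_map _ (isUnit_det_gram (↥(maximalRealSubfield L)) e₀ (isUnit_det_realDiagonal L (kernelLineCM dV) (complexConj_kernelLineCM dV hdV) (kernelLineCM_ne_zero dV hdV0))
      (isUnit_det_TW (↥(maximalRealSubfield L)) ε))
  have hb₁ : ∀ y : Fin n₀ → (v.adicCompletion ↥(maximalRealSubfield L)), Continuous fun u : Fin n₀ → (v.adicCompletion ↥(maximalRealSubfield L)) => Matrix.toLinearMap₂' (v.adicCompletion ↥(maximalRealSubfield L)) (localGram (↥(maximalRealSubfield L)) n₀ (gram (↥(maximalRealSubfield L)) e₀ (realDiagonal L (kernelLineCM dV) (complexConj_kernelLineCM dV hdV)) (TW (↥(maximalRealSubfield L)) ε)) v) u y := by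
    intro y
    simp only [Matrix.toLinearMap₂'_apply', dotProduct]
    exact continuous_finsetSum _ fun i _ => (continuous_apply i).mul continuous_const
  have hH₁ : (localGram (↥(maximalRealSubfield L)) n₀ (gram (↥(maximalRealSubfield L)) e₀ (realDiagonal L (kernelLineCM dV) (complexConj_kernelLineCM dV hdV)) (TW (↥(maximalRealSubfield L)) ε)) v).map (toLocalRing L v) = Matrix.reindex e₀ e₀ (((Matrix.diagonal (kernelLineCM dV)).map (algebraMap L (UnitaryGroup.LocalRing L v))) ⊗ₖ
      ((JW (↥(maximalRealSubfield L)) L ε).map (algebraMap L (UnitaryGroup.LocalRing L v)))) := by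
    rw [localGram, ← localForm_eq_map L n₀ v _ (reindex_kronecker_eq_gram_map (↥(maximalRealSubfield L)) L e₀ (realDiagonal_map L (kernelLineCM dV) (complexConj_kernelLineCM dV hdV)).symm
      (JW_eq (↥(maximalRealSubfield L)) L ε)), adelicForm, Matrix.map_map, kronecker_map_map]
    have hcomp : ((adeleToLocal L v : AdeleRing (𝓞 L) L →+* (UnitaryGroup.LocalRing L v)) : AdeleRing (𝓞 L) L → (UnitaryGroup.LocalRing L v)) ∘
        (algebraMap L (AdeleRing (𝓞 L) L)) = algebraMap L (UnitaryGroup.LocalRing L v) := funext fun e => adeleToLocal_algebraMap L v e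
    rw [hcomp]
    ext i j
    simp only [Matrix.reindex_apply, Matrix.submatrix_apply, Matrix.map_apply]
  obtain ⟨t₁, ht₁⟩ : ∃ t₁ : (v.adicCompletion ↥(maximalRealSubfield L)), t₁ = (localGram (↥(maximalRealSubfield L)) n₀ (gram (↥(maximalRealSubfield L)) e₀ (realDiagonal L (kernelLineCM dV) (complexConj_kernelLineCM dV hdV)) (TW (↥(maximalRealSubfield L)) ε)) v) (eι.symm 0) (eι.symm 0) := ⟨_, rfl⟩
  have hφt₁ : toLocalRing L v t₁ = algebraMap L (UnitaryGroup.LocalRing L v) (kernelLineCM dV 0) * εS := by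
    have hm : toLocalRing L v t₁ = ((localGram (↥(maximalRealSubfield L)) n₀ (gram (↥(maximalRealSubfield L)) e₀ (realDiagonal L (kernelLineCM dV) (complexConj_kernelLineCM dV hdV)) (TW (↥(maximalRealSubfield L)) ε)) v).map (toLocalRing L v)) (eι.symm 0) (eι.symm 0) := by rw [ht₁, Matrix.map_apply]
    rw [hm, hH₁, hi₀, Matrix.reindex_apply, Matrix.submatrix_apply, Equiv.symm_apply_apply, Matrix.kroneckerMap_apply, Matrix.map_apply,
      Matrix.map_apply, Matrix.diagonal_apply_eq, hεS, JW_eq, Matrix.map_apply, TW]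
    rfl
  have ht₁0 : t₁ ≠ 0 := by
    intro h0
    have hu : IsUnit (toLocalRing L v t₁) := by
      rw [hφt₁]; exact (((isUnit_iff_ne_zero.mpr (kernelLineCM_ne_zero dV hdV0 0)).map _).mul hεSu)
    rw [h0, map_zero] at hu
    exact not_isUnit_zero hu
  -- `κ := a² ε̃ ∕ det T`, `N(κ) = a₀ t₁` (the Witt-kernel-line identity `−d₁d₂d₃ · a = N(a² ∕ det T)`)
  obtain ⟨κ, hκdef⟩ : ∃ κ : (UnitaryGroup.LocalRing L v), κ = a * a * εS * Xi := ⟨_, rfl⟩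
  have hκu : IsUnit κ := by
    rw [hκdef]; exact ((ha.mul ha).mul hεSu).mul (IsUnit.of_mul_eq_one _ hXi1)
  have hkL : algebraMap L (UnitaryGroup.LocalRing L v) (kernelLineCM dV 0) = -Dv := by rw [hDv, kernelLineCM, map_neg]
  have hκN : κ * (conjLocal L (IsCMField.complexConj L) v) κ = toLocalRing L v (a₀ * t₁) := by
    rw [map_mul, ← hua₀, hφt₁, hkL, hDv', huu, ← hεS, hκdef, map_mul, map_mul, map_mul, hσa, hσε]
    ring
  have hκ : re (quadraticLocalEquiv L v (IsCMField.complexConj L) (complexConj_imagUnit L) (imagUnit_ne_zero L)).toLinearEquiv.toAddEquiv κ * re (quadraticLocalEquiv L v (IsCMField.complexConj L) (complexConj_imagUnit L) (imagUnit_ne_zero L)).toLinearEquiv.toAddEquiv κ - dd * (im (quadraticLocalEquiv L v (IsCMField.complexConj L) (complexConj_imagUnit L) (imagUnit_ne_zero L)).toLinearEquiv.toAddEquiv κ * im (quadraticLocalEquiv L v (IsCMField.complexConj L) (complexConj_imagUnit L) (imagUnit_ne_zero L)).toLinearEquiv.toAddEquiv κ) = a₀ * t₁ :=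
    (toLocalRing L v).injective (by rw [← hnorm, hκN])
  obtain ⟨Γ₁, hΓ₁, hΓ₁s, hΓ₁a⟩ := exists_lineFibreChart hdd eι (localGram (↥(maximalRealSubfield L)) n₀ (gram (↥(maximalRealSubfield L)) e₀ (realDiagonal L (kernelLineCM dV) (complexConj_kernelLineCM dV hdV)) (TW (↥(maximalRealSubfield L)) ε)) v) ht₁.symm ht₁0 ha₀ κ hκ
  have halt₁ := sub_eq_sub_of_alt_eq Γ₁ hΓ₁a
  obtain ⟨Ψ₁, hΨ₁, -⟩ := exists_intertwiner_implements_conj (localGram (↥(maximalRealSubfield L)) n₀ (gram (↥(maximalRealSubfield L)) e₀ (realDiagonal L (kernelLineCM dV) (complexConj_kernelLineCM dV hdV)) (TW (↥(maximalRealSubfield L)) ε)) v) hT₁d (isLocallyConstant_of_isContinuousNontrivial (isContinuousNontrivial_adeleAddCharAt (↥(maximalRealSubfield L)) v)) hb₁ hb₀ Γ₁ hΓ₁a hψ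
    (Heisenberg.conjCoboundaryEquiv Γ₁ halt₁) (fun _ _ => rfl)
  have hφ₁ := Heisenberg.conjCoboundaryEquiv_ofSymplectic_act Γ₁ halt₁
  obtain ⟨s₁, hs₁⟩ : ∃ s₁ : (localPi L (IsCMField.complexConj L) 1 (JW (↥(maximalRealSubfield L)) L ε) v) →* MpPsi (schrodingerSB (Matrix.toLinearMap₂' (v.adicCompletion ↥(maximalRealSubfield L)) (localGram (↥(maximalRealSubfield L)) n₀ (gram (↥(maximalRealSubfield L)) e₀ (realDiagonal L (kernelLineCM dV) (complexConj_kernelLineCM dV hdV)) (TW (↥(maximalRealSubfield L)) ε)) v)) (adeleAddCharAt (↥(maximalRealSubfield L)) v) (isLocallyConstant_of_isContinuousNontrivial (isContinuousNontrivial_adeleAddCharAt (↥(maximalRealSubfield L)) v)) hb₁), s₁ = ((lineSplittingsCM L e₀ (kernelLineCM dV) (complexConj_kernelLineCM dV hdV) (kernelLineCM_ne_zero dV hdV0) (toHeckeCharacter L μ) ((isOscillatorChar_toHeckeCharacter_iff μ).mpr hμ) ε).s v).comp (localCenter L (IsCMField.complexConj L) n₀ (Matrix.reindex e₀ e₀ (Matrix.diagonal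 (kernelLineCM dV) ⊗ₖ JW (↥(maximalRealSubfield L)) L ε)) (JW (↥(maximalRealSubfield L)) L ε) (JW_apply_ne_zero (↥(maximalRealSubfield L)) L ε) v) := ⟨_, rfl⟩
  obtain ⟨ω₁, hω₁⟩ : ∃ ω₁ : (localPi L (IsCMField.complexConj L) 1 (JW (↥(maximalRealSubfield L)) L ε) v) →* MpPsi (schrodingerSB (dotProductBilin (v.adicCompletion ↥(maximalRealSubfield L)) (v.adicCompletion ↥(maximalRealSubfield L)) (m := Fin 1)) (adeleAddCharAt (↥(maximalRealSubfield L)) v) (isLocallyConstant_of_isContinuousNontrivial (isContinuousNontrivial_adeleAddCharAt (↥(maximalRealSubfield L)) v)) (fun y => continuous_dotProductBilin_left y)),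
      ω₁ = (MpPsi.congr (schrodingerSB (Matrix.toLinearMap₂' (v.adicCompletion ↥(maximalRealSubfield L)) (localGram (↥(maximalRealSubfield L)) n₀ (gram (↥(maximalRealSubfield L)) e₀ (realDiagonal L (kernelLineCM dV) (complexConj_kernelLineCM dV hdV)) (TW (↥(maximalRealSubfield L)) ε)) v)) (adeleAddCharAt (↥(maximalRealSubfield L)) v) (isLocallyConstant_of_isContinuousNontrivial (isContinuousNontrivial_adeleAddCharAt (↥(maximalRealSubfield L)) v)) hb₁) (schrodingerSB (dotProductBilin (v.adicCompletion ↥(maximalRealSubfield L)) (v.adicCompletion ↥(maximalRealSubfield L)) (m := Fin 1)) (adeleAddCharAt (↥(maximalRealSubfield L)) v) (isLocallyConstant_of_isContinuousNontrivial (isContinuousNontrivial_adeleAddCharAt (↥(maximalRealSubfield L)) v)) (fun y => continuous_dotProductBilin_left y)) (Φ := Heisenberg.conjCoboundaryEquiv Γ₁ halt₁) (T := Ψ₁) (φ := symplecticConjOfAlt Γ₁ halt₁) hΨ₁ hφ₁).toMonoidHom.comp s₁ :=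
    ⟨_, rfl⟩
  -- the rank-one centre acts on `reIm c` by `c ↦ au • c`, hence `proj (ω₁ u)` on the fibre coordinates by `Γ₁ ∘ (au •) ∘ Γ₁⁻¹`
  have hp₁ : ∀ u, (s₁ u).1.1 = (iota (↥(maximalRealSubfield L)) L (IsCMField.complexConj L) n₀ (complexConj_imagUnit L) (imagUnit_ne_zero L) (imagUnit_mul_self L) (gram (↥(maximalRealSubfield L)) e₀ (realDiagonal L (kernelLineCM dV) (complexConj_kernelLineCM dV hdV)) (TW (↥(maximalRealSubfield L)) ε))
      (isSymm_gram (↥(maximalRealSubfield L)) e₀ (realDiagonal_isSymm L (kernelLineCM dV) (complexConj_kernelLineCM dV hdV)) (isSymm_TW (↥(maximalRealSubfield L)) ε))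
      (reindex_kronecker_eq_gram_map (↥(maximalRealSubfield L)) L e₀ (realDiagonal_map L (kernelLineCM dV) (complexConj_kernelLineCM dV hdV)).symm (JW_eq (↥(maximalRealSubfield L)) L ε)) v) ((localCenter L (IsCMField.complexConj L) n₀ (Matrix.reindex e₀ e₀ (Matrix.diagonal (kernelLineCM dV) ⊗ₖ JW (↥(maximalRealSubfield L)) L ε)) (JW (↥(maximalRealSubfield L)) L ε) (JW_apply_ne_zero (↥(maximalRealSubfield L)) L ε) v) u) := fun u => by
    rw [hs₁]; exact (lineSplittingsCM L e₀ (kernelLineCM dV) (complexConj_kernelLineCM dV hdV) (kernelLineCM_ne_zero dV hdV0) (toHeckeCharacter L μ) ((isOscillatorChar_toHeckeCharacter_iff μ).mpr hμ) ε).proj_s v ((localCenter L (IsCMField.complexConj L) n₀ (Matrix.reindex e₀ e₀ (Matrix.diagonal (kernelLineCM dV) ⊗ₖ JW (↥(maximalRealSubfield L)) L ε)) (JW (↥(maximalRealSubfield L)) L ε) (JW_apply_ne_zero (↥(maximalRealSubfield L)) L ε) v) u)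
  have hι₁ : ∀ (u : (localPi L (IsCMField.complexConj L) 1 (JW (↥(maximalRealSubfield L)) L ε) v)) (c : Fin n₀ → (UnitaryGroup.LocalRing L v)), ((s₁ u).1.1).1 (reIm (quadraticLocalEquiv L v (IsCMField.complexConj L) (complexConj_imagUnit L) (imagUnit_ne_zero L)).toLinearEquiv.toAddEquiv (Fin n₀) c) = reIm (quadraticLocalEquiv L v (IsCMField.complexConj L) (complexConj_imagUnit L) (imagUnit_ne_zero L)).toLinearEquiv.toAddEquiv (Fin n₀) (au u • c) := by
    intro u c
    rw [hp₁, iota_fst_reIm, show (((localPiEquiv L (IsCMField.complexConj L) n₀ (Matrix.reindex e₀ e₀ (Matrix.diagonal (kernelLineCM dV) ⊗ₖ JW (↥(maximalRealSubfield L)) L ε)) v ((localCenter L (IsCMField.complexConj L) n₀ (Matrix.reindex e₀ e₀ (Matrix.diagonal (kernelLineCM dV) ⊗ₖ JW (↥(maximalRealSubfield L)) L ε)) (JW (↥(maximalRealSubfield L)) L ε) (JW_apply_ne_zero (↥(maximalRealSubfield L)) L ε) v) u) :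
        «local» L (IsCMField.complexConj L) n₀ (Matrix.reindex e₀ e₀ (Matrix.diagonal (kernelLineCM dV) ⊗ₖ JW (↥(maximalRealSubfield L)) L ε)) v) : GL (Fin n₀) (UnitaryGroup.LocalRing L v)).val) =
        au u • (1 : Matrix (Fin n₀) (Fin n₀) (UnitaryGroup.LocalRing L v)) from hsc n₀ _ u, Matrix.smul_mulVec, Matrix.one_mulVec]
  have hproj : ∀ (u : (localPi L (IsCMField.complexConj L) 1 (JW (↥(maximalRealSubfield L)) L ε) v)) (p : (Fin 1 → (v.adicCompletion ↥(maximalRealSubfield L))) × (Fin 1 → (v.adicCompletion ↥(maximalRealSubfield L)))),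
      (MpPsi.proj (schrodingerSB (dotProductBilin (v.adicCompletion ↥(maximalRealSubfield L)) (v.adicCompletion ↥(maximalRealSubfield L)) (m := Fin 1)) (adeleAddCharAt (↥(maximalRealSubfield L)) v) (isLocallyConstant_of_isContinuousNontrivial (isContinuousNontrivial_adeleAddCharAt (↥(maximalRealSubfield L)) v)) (fun y => continuous_dotProductBilin_left y)) (ω₁ u)).1 p = Γ₁ (((s₁ u).1.1).1 (Γ₁.symm p)) := fun u p => by rw [hω₁]; rfl
  -- ===== (E2): the centre `z u` is `Y`-stable with induced map `proj (ω₁ u)`; its descent IS `σ u` and implements it =====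
  have hherm : ∀ (x y : Fin n' → (UnitaryGroup.LocalRing L v)) (c : (UnitaryGroup.LocalRing L v)), hermForm (conjLocal L (IsCMField.complexConj L) v) ((localGram (↥(maximalRealSubfield L)) n' (gram (↥(maximalRealSubfield L)) e₁ (realDiagonal L dV hdV) (TW (↥(maximalRealSubfield L)) ε)) v).map (toLocalRing L v)) x (c • y) = c * hermForm (conjLocal L (IsCMField.complexConj L) v) ((localGram (↥(maximalRealSubfield L)) n' (gram (↥(maximalRealSubfield L)) e₁ (realDiagonal L dV hdV) (TW (↥(maximalRealSubfield L)) ε)) v).map (toLocalRing L v)) x y := fun x y c => by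
    rw [hermForm_apply, hermForm_apply, Matrix.mulVec_smul, dotProduct_smul, smul_eq_mul]
  have hw : ∀ w : ((Fin 2 ⊕ Fin 1) → (v.adicCompletion ↥(maximalRealSubfield L))) × ((Fin 2 ⊕ Fin 1) → (v.adicCompletion ↥(maximalRealSubfield L))), ∃ x : Fin n' → (UnitaryGroup.LocalRing L v), Γ (reIm (quadraticLocalEquiv L v (IsCMField.complexConj L) (complexConj_imagUnit L) (imagUnit_ne_zero L)).toLinearEquiv.toAddEquiv (Fin n') x) = w := fun w =>
    ⟨(reIm (quadraticLocalEquiv L v (IsCMField.complexConj L) (complexConj_imagUnit L) (imagUnit_ne_zero L)).toLinearEquiv.toAddEquiv (Fin n')).symm (Γ.symm w), by rw [AddEquiv.apply_symm_apply, LinearEquiv.apply_symm_apply]⟩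
  have himpl : ∀ (u : (localPi L (IsCMField.complexConj L) 1 (JW (↥(maximalRealSubfield L)) L ε) v)) (h₀ : Heisenberg (polar (dotProductBilin (v.adicCompletion ↥(maximalRealSubfield L)) (v.adicCompletion ↥(maximalRealSubfield L)) (m := Fin 1)))) (x : SchwartzBruhat (Fin 1 → (v.adicCompletion ↥(maximalRealSubfield L)))),
      (LinearEquiv.refl ℂ _) (σ u ((LinearEquiv.refl ℂ (SchwartzBruhat (Fin 1 → (v.adicCompletion ↥(maximalRealSubfield L))))).symm ((schrodingerSB (dotProductBilin (v.adicCompletion ↥(maximalRealSubfield L)) (v.adicCompletion ↥(maximalRealSubfield L)) (m := Fin 1)) (adeleAddCharAt (↥(maximalRealSubfield L)) v) (isLocallyConstant_of_isContinuousNontrivial (isContinuousNontrivial_adeleAddCharAt (↥(maximalRealSubfield L)) v)) (fun y => continuous_dotProductBilin_left y)) h₀ ((LinearEquiv.refl ℂ _) x)))) =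
        (schrodingerSB (dotProductBilin (v.adicCompletion ↥(maximalRealSubfield L)) (v.adicCompletion ↥(maximalRealSubfield L)) (m := Fin 1)) (adeleAddCharAt (↥(maximalRealSubfield L)) v) (isLocallyConstant_of_isContinuousNontrivial (isContinuousNontrivial_adeleAddCharAt (↥(maximalRealSubfield L)) v)) (fun y => continuous_dotProductBilin_left y)) ((ofSymplectic _ (MpPsi.proj (schrodingerSB (dotProductBilin (v.adicCompletion ↥(maximalRealSubfield L)) (v.adicCompletion ↥(maximalRealSubfield L)) (m := Fin 1)) (adeleAddCharAt (↥(maximalRealSubfield L)) v) (isLocallyConstant_of_isContinuousNontrivial (isContinuousNontrivial_adeleAddCharAt (↥(maximalRealSubfield L)) v)) (fun y => continuous_dotProductBilin_left y)) (ω₁ u))).act h₀) ((LinearEquiv.refl ℂ _) (σ u x)) := by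
    intro u h₀ x
    simp only [LinearEquiv.refl_apply, LinearEquiv.refl_symm]
    -- (hY): `Y` goes to `Y`
    have hY : ∀ y₁ : Fin 2 → (v.adicCompletion ↥(maximalRealSubfield L)), ∃ y₁' : Fin 2 → (v.adicCompletion ↥(maximalRealSubfield L)), ((s' (z u)).1.1).1 (0, Sum.elim y₁ 0) = (0, Sum.elim y₁' 0) := by
      intro y₁
      obtain ⟨x, hx⟩ := hw (0, Sum.elim y₁ 0)
      have hc := h1 x
      rw [hx] at hc
      have e1 : re (quadraticLocalEquiv L v (IsCMField.complexConj L) (complexConj_imagUnit L) (imagUnit_ne_zero L)).toLinearEquiv.toAddEquiv (hermForm (conjLocal L (IsCMField.complexConj L) v) ((localGram (↥(maximalRealSubfield L)) n' (gram (↥(maximalRealSubfield L)) e₁ (realDiagonal L dV hdV) (TW (↥(maximalRealSubfield L)) ε)) v).map (toLocalRing L v)) (fun k => (T : Matrix (Fin 3) (Fin 3) (UnitaryGroup.LocalRing L v)) (e₁.symm k).1 0) x) = 0 := by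
        have := congrFun (congrArg Prod.fst hc) (Sum.inl 0); exact this.symm
      have e2 : im (quadraticLocalEquiv L v (IsCMField.complexConj L) (complexConj_imagUnit L) (imagUnit_ne_zero L)).toLinearEquiv.toAddEquiv (hermForm (conjLocal L (IsCMField.complexConj L) v) ((localGram (↥(maximalRealSubfield L)) n' (gram (↥(maximalRealSubfield L)) e₁ (realDiagonal L dV hdV) (TW (↥(maximalRealSubfield L)) ε)) v).map (toLocalRing L v)) (fun k => (T : Matrix (Fin 3) (Fin 3) (UnitaryGroup.LocalRing L v)) (e₁.symm k).1 0) x) = 0 := by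
        have := congrFun (congrArg Prod.fst hc) (Sum.inl 1); exact this.symm
      have e3 : re (quadraticLocalEquiv L v (IsCMField.complexConj L) (complexConj_imagUnit L) (imagUnit_ne_zero L)).toLinearEquiv.toAddEquiv (hermForm (conjLocal L (IsCMField.complexConj L) v) ((localGram (↥(maximalRealSubfield L)) n' (gram (↥(maximalRealSubfield L)) e₁ (realDiagonal L dV hdV) (TW (↥(maximalRealSubfield L)) ε)) v).map (toLocalRing L v)) (fun k => (T : Matrix (Fin 3) (Fin 3) (UnitaryGroup.LocalRing L v)) (e₁.symm k).1 1) x) = 0 := by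
        have := congrFun (congrArg Prod.fst hc) (Sum.inr 0)
        have h3' : a₀⁻¹ * re (quadraticLocalEquiv L v (IsCMField.complexConj L) (complexConj_imagUnit L) (imagUnit_ne_zero L)).toLinearEquiv.toAddEquiv (hermForm (conjLocal L (IsCMField.complexConj L) v) ((localGram (↥(maximalRealSubfield L)) n' (gram (↥(maximalRealSubfield L)) e₁ (realDiagonal L dV hdV) (TW (↥(maximalRealSubfield L)) ε)) v).map (toLocalRing L v)) (fun k => (T : Matrix (Fin 3) (Fin 3) (UnitaryGroup.LocalRing L v)) (e₁.symm k).1 1) x) = 0 := this.symm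
        rcases mul_eq_zero.1 h3' with h' | h'
        · exact absurd h' (inv_ne_zero ha₀)
        · exact h'
      have e4 : im (quadraticLocalEquiv L v (IsCMField.complexConj L) (complexConj_imagUnit L) (imagUnit_ne_zero L)).toLinearEquiv.toAddEquiv (hermForm (conjLocal L (IsCMField.complexConj L) v) ((localGram (↥(maximalRealSubfield L)) n' (gram (↥(maximalRealSubfield L)) e₁ (realDiagonal L dV hdV) (TW (↥(maximalRealSubfield L)) ε)) v).map (toLocalRing L v)) (fun k => (T : Matrix (Fin 3) (Fin 3) (UnitaryGroup.LocalRing L v)) (e₁.symm k).1 1) x) = 0 := by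
        have := congrFun (congrArg Prod.snd hc) (Sum.inr 0); exact this.symm
      have hz0 : hermForm (conjLocal L (IsCMField.complexConj L) v) ((localGram (↥(maximalRealSubfield L)) n' (gram (↥(maximalRealSubfield L)) e₁ (realDiagonal L dV hdV) (TW (↥(maximalRealSubfield L)) ε)) v).map (toLocalRing L v)) (fun k => (T : Matrix (Fin 3) (Fin 3) (UnitaryGroup.LocalRing L v)) (e₁.symm k).1 0) x = 0 := hzero _ e1 e2
      have hzb : hermForm (conjLocal L (IsCMField.complexConj L) v) ((localGram (↥(maximalRealSubfield L)) n' (gram (↥(maximalRealSubfield L)) e₁ (realDiagonal L dV hdV) (TW (↥(maximalRealSubfield L)) ε)) v).map (toLocalRing L v)) (fun k => (T : Matrix (Fin 3) (Fin 3) (UnitaryGroup.LocalRing L v)) (e₁.symm k).1 1) x = 0 := hzero _ e3 e4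
      refine ⟨![im (quadraticLocalEquiv L v (IsCMField.complexConj L) (complexConj_imagUnit L) (imagUnit_ne_zero L)).toLinearEquiv.toAddEquiv (hermForm (conjLocal L (IsCMField.complexConj L) v) ((localGram (↥(maximalRealSubfield L)) n' (gram (↥(maximalRealSubfield L)) e₁ (realDiagonal L dV hdV) (TW (↥(maximalRealSubfield L)) ε)) v).map (toLocalRing L v)) (fun k => ((uu⁻¹ : (UnitaryGroup.LocalRing L v)ˣ) : (UnitaryGroup.LocalRing L v)) * (T : Matrix (Fin 3) (Fin 3) (UnitaryGroup.LocalRing L v)) (e₁.symm k).1 2) (au u • x)), -re (quadraticLocalEquiv L v (IsCMField.complexConj L) (complexConj_imagUnit L) (imagUnit_ne_zero L)).toLinearEquiv.toAddEquiv (hermForm (conjLocal L (IsCMField.complexConj L) v) ((localGram (↥(maximalRealSubfield L)) n' (gram (↥(maximalRealSubfield L)) e₁ (realDiagonal L dV hdV) (TW (↥(maximalRealSubfield L)) ε)) v).map (toLocalRing L v)) (fun k => ((uu⁻¹ : (UnitaryGroup.LocalRing L v)ˣ) : (UnitaryGroup.LocalRing L v)) * (T : Matrix (Fin 3) (Fin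 3) (UnitaryGroup.LocalRing L v)) (e₁.symm k).1 2) (au u • x))], ?_⟩
      have hx0' : hermForm (conjLocal L (IsCMField.complexConj L) v) ((localGram (↥(maximalRealSubfield L)) n' (gram (↥(maximalRealSubfield L)) e₁ (realDiagonal L dV hdV) (TW (↥(maximalRealSubfield L)) ε)) v).map (toLocalRing L v)) (fun k => (T : Matrix (Fin 3) (Fin 3) (UnitaryGroup.LocalRing L v)) (e₁.symm k).1 0) (au u • x) = 0 := by rw [hherm, hz0, mul_zero]
      have hb1' : hermForm (conjLocal L (IsCMField.complexConj L) v) ((localGram (↥(maximalRealSubfield L)) n' (gram (↥(maximalRealSubfield L)) e₁ (realDiagonal L dV hdV) (TW (↥(maximalRealSubfield L)) ε)) v).map (toLocalRing L v)) (fun k => (T : Matrix (Fin 3) (Fin 3) (UnitaryGroup.LocalRing L v)) (e₁.symm k).1 1) (au u • x) = 0 := by rw [hherm, hzb, mul_zero]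
      rw [← hx, h4z, h1, hx0', hb1', map_zero, map_zero, mul_zero]
      refine Prod.ext (funext fun i => ?_) rfl
      rcases i with i | i
      · fin_cases i <;> rfl
      · rfl
    -- (hYp): `Y^⊥` goes to `Y^⊥` with induced map `proj (ω₁ u)`
    have hYp : ∀ w : ((Fin 2 ⊕ Fin 1) → (v.adicCompletion ↥(maximalRealSubfield L))) × ((Fin 2 ⊕ Fin 1) → (v.adicCompletion ↥(maximalRealSubfield L))), w.1 ∘ Sum.inl = 0 →
        (((s' (z u)).1.1).1 w).1 ∘ Sum.inl = 0 ∧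
          ((((s' (z u)).1.1).1 w).1 ∘ Sum.inr, (((s' (z u)).1.1).1 w).2 ∘ Sum.inr) = (MpPsi.proj (schrodingerSB (dotProductBilin (v.adicCompletion ↥(maximalRealSubfield L)) (v.adicCompletion ↥(maximalRealSubfield L)) (m := Fin 1)) (adeleAddCharAt (↥(maximalRealSubfield L)) v) (isLocallyConstant_of_isContinuousNontrivial (isContinuousNontrivial_adeleAddCharAt (↥(maximalRealSubfield L)) v)) (fun y => continuous_dotProductBilin_left y)) (ω₁ u)).1 (w.1 ∘ Sum.inr, w.2 ∘ Sum.inr) := by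
      intro w hw0
      obtain ⟨x, rfl⟩ := hw w
      have e1 : re (quadraticLocalEquiv L v (IsCMField.complexConj L) (complexConj_imagUnit L) (imagUnit_ne_zero L)).toLinearEquiv.toAddEquiv (hermForm (conjLocal L (IsCMField.complexConj L) v) ((localGram (↥(maximalRealSubfield L)) n' (gram (↥(maximalRealSubfield L)) e₁ (realDiagonal L dV hdV) (TW (↥(maximalRealSubfield L)) ε)) v).map (toLocalRing L v)) (fun k => (T : Matrix (Fin 3) (Fin 3) (UnitaryGroup.LocalRing L v)) (e₁.symm k).1 0) x) = 0 := by
        have := congrFun hw0 0; rw [Function.comp_apply, h1] at this; exact this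
      have e2 : im (quadraticLocalEquiv L v (IsCMField.complexConj L) (complexConj_imagUnit L) (imagUnit_ne_zero L)).toLinearEquiv.toAddEquiv (hermForm (conjLocal L (IsCMField.complexConj L) v) ((localGram (↥(maximalRealSubfield L)) n' (gram (↥(maximalRealSubfield L)) e₁ (realDiagonal L dV hdV) (TW (↥(maximalRealSubfield L)) ε)) v).map (toLocalRing L v)) (fun k => (T : Matrix (Fin 3) (Fin 3) (UnitaryGroup.LocalRing L v)) (e₁.symm k).1 0) x) = 0 := by
        have := congrFun hw0 1; rw [Function.comp_apply, h1] at this; exact this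
      have hz0 : hermForm (conjLocal L (IsCMField.complexConj L) v) ((localGram (↥(maximalRealSubfield L)) n' (gram (↥(maximalRealSubfield L)) e₁ (realDiagonal L dV hdV) (TW (↥(maximalRealSubfield L)) ε)) v).map (toLocalRing L v)) (fun k => (T : Matrix (Fin 3) (Fin 3) (UnitaryGroup.LocalRing L v)) (e₁.symm k).1 0) x = 0 := hzero _ e1 e2
      -- the `𝕎₁`-coordinates `(a₀⁻¹ re z_b, im z_b)` are `Γ₁ (reIm c)` with `κ • c = z_b`
      obtain ⟨zb, hzb⟩ : ∃ zb : (UnitaryGroup.LocalRing L v), zb = hermForm (conjLocal L (IsCMField.complexConj L) v) ((localGram (↥(maximalRealSubfield L)) n' (gram (↥(maximalRealSubfield L)) e₁ (realDiagonal L dV hdV) (TW (↥(maximalRealSubfield L)) ε)) v).map (toLocalRing L v)) (fun k => (T : Matrix (Fin 3) (Fin 3) (UnitaryGroup.LocalRing L v)) (e₁.symm k).1 1) x := ⟨_, rfl⟩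
      have hΓc : Γ₁ (reIm (quadraticLocalEquiv L v (IsCMField.complexConj L) (complexConj_imagUnit L) (imagUnit_ne_zero L)).toLinearEquiv.toAddEquiv (Fin n₀) (fun _ => ((hκu.unit⁻¹ : (UnitaryGroup.LocalRing L v)ˣ) : (UnitaryGroup.LocalRing L v)) * zb)) = (fun _ => a₀⁻¹ * re (quadraticLocalEquiv L v (IsCMField.complexConj L) (complexConj_imagUnit L) (imagUnit_ne_zero L)).toLinearEquiv.toAddEquiv zb, fun _ => im (quadraticLocalEquiv L v (IsCMField.complexConj L) (complexConj_imagUnit L) (imagUnit_ne_zero L)).toLinearEquiv.toAddEquiv zb) := by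
        rw [hΓ₁, ← mul_assoc, IsUnit.mul_val_inv, one_mul]
      have hΓc' : Γ₁ (reIm (quadraticLocalEquiv L v (IsCMField.complexConj L) (complexConj_imagUnit L) (imagUnit_ne_zero L)).toLinearEquiv.toAddEquiv (Fin n₀) (au u • fun _ => ((hκu.unit⁻¹ : (UnitaryGroup.LocalRing L v)ˣ) : (UnitaryGroup.LocalRing L v)) * zb)) =
          (fun _ => a₀⁻¹ * re (quadraticLocalEquiv L v (IsCMField.complexConj L) (complexConj_imagUnit L) (imagUnit_ne_zero L)).toLinearEquiv.toAddEquiv (au u * zb), fun _ => im (quadraticLocalEquiv L v (IsCMField.complexConj L) (complexConj_imagUnit L) (imagUnit_ne_zero L)).toLinearEquiv.toAddEquiv (au u * zb)) := by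
        rw [hΓ₁, Pi.smul_apply, smul_eq_mul, mul_left_comm, ← mul_assoc κ, IsUnit.mul_val_inv, one_mul]
      refine ⟨?_, ?_⟩
      · rw [h4z, h1]
        change (![re (quadraticLocalEquiv L v (IsCMField.complexConj L) (complexConj_imagUnit L) (imagUnit_ne_zero L)).toLinearEquiv.toAddEquiv (hermForm (conjLocal L (IsCMField.complexConj L) v) ((localGram (↥(maximalRealSubfield L)) n' (gram (↥(maximalRealSubfield L)) e₁ (realDiagonal L dV hdV) (TW (↥(maximalRealSubfield L)) ε)) v).map (toLocalRing L v)) (fun k => (T : Matrix (Fin 3) (Fin 3) (UnitaryGroup.LocalRing L v)) (e₁.symm k).1 0) (au u • x)), im (quadraticLocalEquiv L v (IsCMField.complexConj L) (complexConj_imagUnit L) (imagUnit_ne_zero L)).toLinearEquiv.toAddEquiv (hermForm (conjLocal L (IsCMField.complexConj L) v) ((localGram (↥(maximalRealSubfield L)) n' (gram (↥(maximalRealSubfield L)) e₁ (realDiagonal L dV hdV) (TW (↥(maximalRealSubfield L)) ε)) v).map (toLocalRing L v)) (fun k => (T : Matrix (Fin 3) (Fin 3) (UnitaryGroup.LocalRing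 L v)) (e₁.symm k).1 0) (au u • x))] : Fin 2 → (v.adicCompletion ↥(maximalRealSubfield L))) = 0
        rw [hherm, hz0, mul_zero, map_zero, map_zero]
        funext i; fin_cases i <;> rfl
      · -- the `𝕎₁`-coordinates, rewritten WITHOUT `rw`∕`change` on `S`-valued goals (the CM-carrier `isDefEq` wall): closed `congrArg` chains only
        have hzb' : hermForm (conjLocal L (IsCMField.complexConj L) v) ((localGram (↥(maximalRealSubfield L)) n' (gram (↥(maximalRealSubfield L)) e₁ (realDiagonal L dV hdV) (TW (↥(maximalRealSubfield L)) ε)) v).map (toLocalRing L v)) (fun k => (T : Matrix (Fin 3) (Fin 3) (UnitaryGroup.LocalRing L v)) (e₁.symm k).1 1) (au u • x) = au u * zb := by rw [hherm, hzb]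
        have eL : ((((s' (z u)).1.1).1 (Γ (reIm (quadraticLocalEquiv L v (IsCMField.complexConj L) (complexConj_imagUnit L) (imagUnit_ne_zero L)).toLinearEquiv.toAddEquiv (Fin n') x))).1 ∘ Sum.inr, (((s' (z u)).1.1).1 (Γ (reIm (quadraticLocalEquiv L v (IsCMField.complexConj L) (complexConj_imagUnit L) (imagUnit_ne_zero L)).toLinearEquiv.toAddEquiv (Fin n') x))).2 ∘ Sum.inr) =
            ((fun _ : Fin 1 => a₀⁻¹ * re (quadraticLocalEquiv L v (IsCMField.complexConj L) (complexConj_imagUnit L) (imagUnit_ne_zero L)).toLinearEquiv.toAddEquiv (hermForm (conjLocal L (IsCMField.complexConj L) v) ((localGram (↥(maximalRealSubfield L)) n' (gram (↥(maximalRealSubfield L)) e₁ (realDiagonal L dV hdV) (TW (↥(maximalRealSubfield L)) ε)) v).map (toLocalRing L v)) (fun k => (T : Matrix (Fin 3) (Fin 3) (UnitaryGroup.LocalRing L v)) (e₁.symm k).1 1) (au u • x))),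
              (fun _ : Fin 1 => im (quadraticLocalEquiv L v (IsCMField.complexConj L) (complexConj_imagUnit L) (imagUnit_ne_zero L)).toLinearEquiv.toAddEquiv (hermForm (conjLocal L (IsCMField.complexConj L) v) ((localGram (↥(maximalRealSubfield L)) n' (gram (↥(maximalRealSubfield L)) e₁ (realDiagonal L dV hdV) (TW (↥(maximalRealSubfield L)) ε)) v).map (toLocalRing L v)) (fun k => (T : Matrix (Fin 3) (Fin 3) (UnitaryGroup.LocalRing L v)) (e₁.symm k).1 1) (au u • x)))) :=
          (congrArg (fun w : ((Fin 2 ⊕ Fin 1) → (v.adicCompletion ↥(maximalRealSubfield L))) × ((Fin 2 ⊕ Fin 1) → (v.adicCompletion ↥(maximalRealSubfield L))) => (w.1 ∘ Sum.inr, w.2 ∘ Sum.inr)) ((h4z u x).trans (h1 (au u • x)))).trans rfl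
        have eR : ((Γ (reIm (quadraticLocalEquiv L v (IsCMField.complexConj L) (complexConj_imagUnit L) (imagUnit_ne_zero L)).toLinearEquiv.toAddEquiv (Fin n') x)).1 ∘ Sum.inr, (Γ (reIm (quadraticLocalEquiv L v (IsCMField.complexConj L) (complexConj_imagUnit L) (imagUnit_ne_zero L)).toLinearEquiv.toAddEquiv (Fin n') x)).2 ∘ Sum.inr) =
            ((fun _ : Fin 1 => a₀⁻¹ * re (quadraticLocalEquiv L v (IsCMField.complexConj L) (complexConj_imagUnit L) (imagUnit_ne_zero L)).toLinearEquiv.toAddEquiv (hermForm (conjLocal L (IsCMField.complexConj L) v) ((localGram (↥(maximalRealSubfield L)) n' (gram (↥(maximalRealSubfield L)) e₁ (realDiagonal L dV hdV) (TW (↥(maximalRealSubfield L)) ε)) v).map (toLocalRing L v)) (fun k => (T : Matrix (Fin 3) (Fin 3) (UnitaryGroup.LocalRing L v)) (e₁.symm k).1 1) x)), (fun _ : Fin 1 => im (quadraticLocalEquiv L v (IsCMField.complexConj L) (complexConj_imagUnit L) (imagUnit_ne_zero L)).toLinearEquiv.toAddEquiv (hermForm (conjLocal L (IsCMField.complexConj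 L) v) ((localGram (↥(maximalRealSubfield L)) n' (gram (↥(maximalRealSubfield L)) e₁ (realDiagonal L dV hdV) (TW (↥(maximalRealSubfield L)) ε)) v).map (toLocalRing L v)) (fun k => (T : Matrix (Fin 3) (Fin 3) (UnitaryGroup.LocalRing L v)) (e₁.symm k).1 1) x))) :=
          (congrArg (fun w : ((Fin 2 ⊕ Fin 1) → (v.adicCompletion ↥(maximalRealSubfield L))) × ((Fin 2 ⊕ Fin 1) → (v.adicCompletion ↥(maximalRealSubfield L))) => (w.1 ∘ Sum.inr, w.2 ∘ Sum.inr)) (h1 x)).trans rfl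
        have hR : Γ₁ (((s₁ u).1.1).1 (Γ₁.symm ((fun _ : Fin 1 => a₀⁻¹ * re (quadraticLocalEquiv L v (IsCMField.complexConj L) (complexConj_imagUnit L) (imagUnit_ne_zero L)).toLinearEquiv.toAddEquiv zb), (fun _ : Fin 1 => im (quadraticLocalEquiv L v (IsCMField.complexConj L) (complexConj_imagUnit L) (imagUnit_ne_zero L)).toLinearEquiv.toAddEquiv zb)))) =
            ((fun _ : Fin 1 => a₀⁻¹ * re (quadraticLocalEquiv L v (IsCMField.complexConj L) (complexConj_imagUnit L) (imagUnit_ne_zero L)).toLinearEquiv.toAddEquiv (au u * zb)), (fun _ : Fin 1 => im (quadraticLocalEquiv L v (IsCMField.complexConj L) (complexConj_imagUnit L) (imagUnit_ne_zero L)).toLinearEquiv.toAddEquiv (au u * zb))) :=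
          ((congrArg (fun q => Γ₁ (((s₁ u).1.1).1 (Γ₁.symm q))) hΓc.symm).trans
            ((congrArg (fun q => Γ₁ (((s₁ u).1.1).1 q)) (Γ₁.symm_apply_apply _)).trans
              ((congrArg Γ₁ (hι₁ u _)).trans hΓc')))
        have e1 : (((fun _ : Fin 1 => a₀⁻¹ * re (quadraticLocalEquiv L v (IsCMField.complexConj L) (complexConj_imagUnit L) (imagUnit_ne_zero L)).toLinearEquiv.toAddEquiv (hermForm (conjLocal L (IsCMField.complexConj L) v) ((localGram (↥(maximalRealSubfield L)) n' (gram (↥(maximalRealSubfield L)) e₁ (realDiagonal L dV hdV) (TW (↥(maximalRealSubfield L)) ε)) v).map (toLocalRing L v)) (fun k => (T : Matrix (Fin 3) (Fin 3) (UnitaryGroup.LocalRing L v)) (e₁.symm k).1 1) (au u • x))),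
              (fun _ : Fin 1 => im (quadraticLocalEquiv L v (IsCMField.complexConj L) (complexConj_imagUnit L) (imagUnit_ne_zero L)).toLinearEquiv.toAddEquiv (hermForm (conjLocal L (IsCMField.complexConj L) v) ((localGram (↥(maximalRealSubfield L)) n' (gram (↥(maximalRealSubfield L)) e₁ (realDiagonal L dV hdV) (TW (↥(maximalRealSubfield L)) ε)) v).map (toLocalRing L v)) (fun k => (T : Matrix (Fin 3) (Fin 3) (UnitaryGroup.LocalRing L v)) (e₁.symm k).1 1) (au u • x)))) : (Fin 1 → (v.adicCompletion ↥(maximalRealSubfield L))) × (Fin 1 → (v.adicCompletion ↥(maximalRealSubfield L)))) =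
            ((fun _ : Fin 1 => a₀⁻¹ * re (quadraticLocalEquiv L v (IsCMField.complexConj L) (complexConj_imagUnit L) (imagUnit_ne_zero L)).toLinearEquiv.toAddEquiv (au u * zb)), (fun _ : Fin 1 => im (quadraticLocalEquiv L v (IsCMField.complexConj L) (complexConj_imagUnit L) (imagUnit_ne_zero L)).toLinearEquiv.toAddEquiv (au u * zb))) := by
          rw [hzb']
        have e2 : Γ₁ (((s₁ u).1.1).1 (Γ₁.symm ((fun _ : Fin 1 => a₀⁻¹ * re (quadraticLocalEquiv L v (IsCMField.complexConj L) (complexConj_imagUnit L) (imagUnit_ne_zero L)).toLinearEquiv.toAddEquiv zb), (fun _ : Fin 1 => im (quadraticLocalEquiv L v (IsCMField.complexConj L) (complexConj_imagUnit L) (imagUnit_ne_zero L)).toLinearEquiv.toAddEquiv zb)))) =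
            (MpPsi.proj (schrodingerSB (dotProductBilin (v.adicCompletion ↥(maximalRealSubfield L)) (v.adicCompletion ↥(maximalRealSubfield L)) (m := Fin 1)) (adeleAddCharAt (↥(maximalRealSubfield L)) v) (isLocallyConstant_of_isContinuousNontrivial (isContinuousNontrivial_adeleAddCharAt (↥(maximalRealSubfield L)) v)) (fun y => continuous_dotProductBilin_left y)) (ω₁ u)).1 ((Γ (reIm (quadraticLocalEquiv L v (IsCMField.complexConj L) (complexConj_imagUnit L) (imagUnit_ne_zero L)).toLinearEquiv.toAddEquiv (Fin n') x)).1 ∘ Sum.inr, (Γ (reIm (quadraticLocalEquiv L v (IsCMField.complexConj L) (complexConj_imagUnit L) (imagUnit_ne_zero L)).toLinearEquiv.toAddEquiv (Fin n') x)).2 ∘ Sum.inr) := by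
          rw [eR, ← hzb]
          exact (hproj u _).symm
        exact eL.trans (e1.trans (hR.symm.trans e2))
    -- the descent of `s′ (z u)` and its identification with `σ u`
    obtain ⟨D, hD1, hD2⟩ := exists_descent_implements (isLocallyConstant_of_isContinuousNontrivial (isContinuousNontrivial_adeleAddCharAt (↥(maximalRealSubfield L)) v)) (fun y => continuous_dotProductBilin_left y) hb₀ φ₀ hφ₀ (s' (z u))
      (MpPsi.proj (schrodingerSB (dotProductBilin (v.adicCompletion ↥(maximalRealSubfield L)) (v.adicCompletion ↥(maximalRealSubfield L)) (m := Fin 1)) (adeleAddCharAt (↥(maximalRealSubfield L)) v) (isLocallyConstant_of_isContinuousNontrivial (isContinuousNontrivial_adeleAddCharAt (↥(maximalRealSubfield L)) v)) (fun y => continuous_dotProductBilin_left y)) (ω₁ u)) hY hYp hψ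
    have hσD : ∀ f, σ u (π f) = D (π f) := fun f =>
      ((hσ' u f).symm.trans ((hπap _).trans ((congrArg φ₀ (h3z u f)).trans (hD1 (Ψ f)).symm))).trans (congrArg D (hπap f).symm)
    have hσD' : ∀ y, σ u y = D y := fun y => by
      obtain ⟨f, rfl⟩ := hπ y
      exact hσD f
    exact (hσD' _).trans ((hD2 h₀ x).trans (congrArg _ (hσD' x).symm))
  -- ===== (o3): the dictionary up to a character =====
  haveI : Nontrivial (SchwartzBruhat (Fin 1 → (v.adicCompletion ↥(maximalRealSubfield L)))) := ⟨⟨piBallSB (v.adicCompletion ↥(maximalRealSubfield L)) (Fin 1) 0, 0, piBallSB_zero_ne_zero⟩⟩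
  obtain ⟨η, hη⟩ := exists_character_dictionary (schrodingerSB (dotProductBilin (v.adicCompletion ↥(maximalRealSubfield L)) (v.adicCompletion ↥(maximalRealSubfield L)) (m := Fin 1)) (adeleAddCharAt (↥(maximalRealSubfield L)) v) (isLocallyConstant_of_isContinuousNontrivial (isContinuousNontrivial_adeleAddCharAt (↥(maximalRealSubfield L)) v)) (fun y => continuous_dotProductBilin_left y)) σ (LinearEquiv.refl ℂ _) ω₁
    (implementerUniqueUpToScalar_schrodingerSB_pi (isLocallyConstant_of_isContinuousNontrivial (isContinuousNontrivial_adeleAddCharAt (↥(maximalRealSubfield L)) v)) (fun y => continuous_dotProductBilin_left y) hψ) himpl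
  -- ===== `hTr` with `Tr := Ψ₁⁻¹` =====
  have hωline : ∀ (u : (localPi L (IsCMField.complexConj L) 1 (JW (↥(maximalRealSubfield L)) L ε) v)) (f : SchwartzBruhat (Fin n₀ → (v.adicCompletion ↥(maximalRealSubfield L)))), lineWeilCM L e₀ (kernelLineCM dV) (complexConj_kernelLineCM dV hdV) (kernelLineCM_ne_zero dV hdV0) μ hμ ε v u f = MpPsi.toRep (schrodingerSB (Matrix.toLinearMap₂' (v.adicCompletion ↥(maximalRealSubfield L)) (localGram (↥(maximalRealSubfield L)) n₀ (gram (↥(maximalRealSubfield L)) e₀ (realDiagonal L (kernelLineCM dV) (complexConj_kernelLineCM dV hdV)) (TW (↥(maximalRealSubfield L)) ε)) v)) (adeleAddCharAt (↥(maximalRealSubfield L)) v) (isLocallyConstant_of_isContinuousNontrivial (isContinuousNontrivial_adeleAddCharAt (↥(maximalRealSubfield L)) v)) hb₁) (s₁ u) f := fun u f => by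
    rw [hs₁]; rfl
  have hωΨ : ∀ (u : (localPi L (IsCMField.complexConj L) 1 (JW (↥(maximalRealSubfield L)) L ε) v)) (f : SchwartzBruhat (Fin n₀ → (v.adicCompletion ↥(maximalRealSubfield L)))), MpPsi.toRep (schrodingerSB (dotProductBilin (v.adicCompletion ↥(maximalRealSubfield L)) (v.adicCompletion ↥(maximalRealSubfield L)) (m := Fin 1)) (adeleAddCharAt (↥(maximalRealSubfield L)) v) (isLocallyConstant_of_isContinuousNontrivial (isContinuousNontrivial_adeleAddCharAt (↥(maximalRealSubfield L)) v)) (fun y => continuous_dotProductBilin_left y)) (ω₁ u) (Ψ₁ f) = Ψ₁ (MpPsi.toRep (schrodingerSB (Matrix.toLinearMap₂' (v.adicCompletion ↥(maximalRealSubfield L)) (localGram (↥(maximalRealSubfield L)) n₀ (gram (↥(maximalRealSubfield L)) e₀ (realDiagonal L (kernelLineCM dV) (complexConj_kernelLineCM dV hdV)) (TW (↥(maximalRealSubfield L)) ε)) v)) (adeleAddCharAt (↥(maximalRealSubfield L)) v) (isLocallyConstant_of_isContinuousNontrivial (isContinuousNontrivial_adeleAddCharAt (↥(maximalRealSubfield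 L)) v)) hb₁) (s₁ u) f) := by
    intro u f
    rw [hω₁]
    exact MpPsi.toRep_congr_comp_apply _ _ hΨ₁ hφ₁ s₁ u f
  refine ⟨π, σ, Ψ₁.symm, η, hπ, hkerπ, hσ', fun u s => ?_⟩
  have key := hη u (Ψ₁ (Ψ₁.symm s))
  simp only [LinearEquiv.refl_apply] at key
  rw [hωΨ, ← hωline, LinearEquiv.apply_symm_apply] at key
  -- `key : Ψ₁ (ω¹ u (Ψ₁⁻¹ s)) = η u • σ u s`
  have := congrArg Ψ₁.symm key
  rw [LinearEquiv.symm_apply_apply, map_smul] at this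
  exact this

end Summit.HodgeConjecture.HodgeConjecture.Cruxes.H413.F0P2oLineWeilDictionaryUpToChar

end
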